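import Summits.PneNP.PneNP.Theorems.ChebyshevTracialDesignGlobalMisalignment
import HarnessLib

/-!
# Cell pnp-psdrank, route `ChebyshevTracialDesign`: global misalignment on CELLS — aligned overlap of a tight psd rectangle lives only on
# sparse index rectangles (crux `TracialDecayExp20`, stmt-PneNP-19878)

Brick 37 (prover g9), a corollary file of brick 36 (`…GlobalMisalignment`). Restricting a tight-orthogonal psd rectangle `(X, Y)` to an index
rectangle `A × B` (`X_U ↦ X_U·1[U ∈ A]`, `Y_M ↦ Y_M·1[M ∈ B]`) keeps it a tight-orthogonal psd rectangle (`isPsdRect_restrict`), so brick 36 applies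
cell by cell: for `t = 2c'+1 ≤ n/2`, every family `A` of `t`-cuts and every family `B` of perfect matchings,

  `tr((Σ_{U∈A} X_U)(Σ_{M∈B} Y_M)) ≤ √(C(n,t)·|PM_n|/n · (Σ_{U∈A} tr X_U)(Σ_{M∈B} tr Y_M))`           (`cell_trace_sum_mul_sum_le`),

i.e. with the RELATIVE quantities of the cell — index densities `μ = |A|/C(n,t)`, `ν = |B|/|PM_n|`, trace densities `τ̃_X = E_{U∈A} tr X_U/r`,
`τ̃_Y = E_{M∈B} tr Y_M/r`, and average overlap `ω̄ = E_{U∈A, M∈B} tr(X_U Y_M)/r` —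

  `ω̄ ≤ √(τ̃_X τ̃_Y / (n·μ·ν))`      (`cell_avg_overlap_le`),     equivalently     `μ·ν ≤ τ̃_X τ̃_Y/(n·ω̄²)`      (`cell_density_product_le`).

So a cell on which the two sides are ALIGNED (average overlap `ω̄ ≥ θ·√(τ̃_X τ̃_Y)`) has index-density product `μν ≤ 1/(θ² n)`: the psd
analogue of "a tight-free rectangle has `μν ≤ 1/n`" (the tree's σ₂ brick), now for the aligned part of an arbitrary tight psd strategy of
arbitrary dimension. In p1's programme (N2 §PSD (4): 'the contradiction needs cells inside which the two sides are aligned') this quantifies how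
small aligned cells must be. [cite: BrouwerHaemers2012, Prop. 4.3.2 (PDF p. 83)] [cite: GodsilMeagher2015, §15.2] [cite: Rothvoss2017, §2 (PDF p. 6)]
Stature: support/instrument. WHAT THIS IS NOT: no bound on the design value, nothing on psd rank of P_PM, no P-vs-NP content.
-/

set_option linter.dupNamespace false -- `Summit.PneNP.PneNP.…`: summit = sub-problem (D-0017)

noncomputable section

namespace Summit.PneNP.PneNP.Theorems.ChebyshevTracialDesignGlobalMisalignmentCells

open scoped Classical

open Finset Matrix Literature.Barriers.PneNP Literature.Combinatorics.Optimization
open Summit.PneNP.PneNP.Theorems.ChebyshevTracialDesignGlobalMisalignment (trace_sum_mul_sum_le_of_isPsdRect)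
open Summit.PneNP.PneNP.Theorems.ChebyshevTracialDesignRungCells (card_tcuts_eq_choose)
open Summit.PneNP.PneNP.Theorems.ChebyshevTracialDesignProfilePolynomial (card_pmatch_pos)

variable {n : ℕ}

/-- **Restriction keeps tightness and psd-ness.** Zeroing a tight-orthogonal psd rectangle outside an index rectangle `A × B` gives a
tight-orthogonal psd rectangle. -/
theorem isPsdRect_restrict {r : ℕ} {X : OddSet n → Matrix (Fin r) (Fin r) ℝ} {Y : PMatch n → Matrix (Fin r) (Fin r) ℝ}
    (hXY : IsPsdRect X Y) (A : Finset (OddSet n)) (B : Finset (PMatch n)) :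
    IsPsdRect (fun U => if U ∈ A then X U else 0) (fun M => if M ∈ B then Y M else 0) := by
  refine ⟨fun U => ?_, fun M => ?_, fun U M hUM => ?_⟩
  · by_cases hU : U ∈ A
    · simp only [hU, if_true]; exact hXY.1 U
    · simp only [hU, if_false, sub_zero]; exact ⟨PosSemidef.zero, PosSemidef.one⟩
  · by_cases hM : M ∈ B
    · simp only [hM, if_true]; exact hXY.2.1 M
    · simp only [hM, if_false, sub_zero]; exact ⟨PosSemidef.zero, PosSemidef.one⟩
  · dsimp only
    split_ifs
    · exact hXY.2.2 U M hUM
    all_goals simp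

/-- **Global misalignment on a cell, trace form.** For `n` even, `t = 2c'+1 ≤ n/2`, a tight-orthogonal psd rectangle `(X, Y)` of any dimension,
a family `A` of `t`-cuts and a family `B` of perfect matchings:
`tr((Σ_{U∈A} X_U)(Σ_{M∈B} Y_M)) ≤ √(C(n,t)·|PM_n|/n · (Σ_{U∈A} tr X_U)(Σ_{M∈B} tr Y_M))`. [cite: BrouwerHaemers2012, Prop. 4.3.2 (PDF p. 83)] -/
theorem cell_trace_sum_mul_sum_le {r c' : ℕ} (hn : Even n) (ht : 2 * (2 * c' + 1) ≤ n)
    {X : OddSet n → Matrix (Fin r) (Fin r) ℝ} {Y : PMatch n → Matrix (Fin r) (Fin r) ℝ} (hXY : IsPsdRect X Y)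
    (A : Finset (OddSet n)) (hA : ∀ U ∈ A, U.1.card = 2 * c' + 1) (B : Finset (PMatch n)) :
    ((∑ U ∈ A, X U) * ∑ M ∈ B, Y M).trace ≤
      Real.sqrt ((n.choose (2 * c' + 1) : ℝ) * (Fintype.card (PMatch n) : ℝ) / n * ((∑ U ∈ A, (X U).trace) * ∑ M ∈ B, (Y M).trace)) := by
  have h := trace_sum_mul_sum_le_of_isPsdRect hn ht (isPsdRect_restrict hXY A B)
  have hAT : (univ.filter (fun U : OddSet n => U.1.card = 2 * c' + 1)).filter (fun U => U ∈ A) = A := by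
    ext U
    simp only [mem_filter, mem_univ, true_and]
    exact ⟨fun h => h.2, fun h => ⟨hA U h, h⟩⟩
  have hX : ∑ U ∈ univ.filter (fun U : OddSet n => U.1.card = 2 * c' + 1), (if U ∈ A then X U else 0) = ∑ U ∈ A, X U := by
    rw [← sum_filter, hAT]
  have hXt : ∑ U ∈ univ.filter (fun U : OddSet n => U.1.card = 2 * c' + 1), (if U ∈ A then X U else 0).trace = ∑ U ∈ A, (X U).trace := by
    have e : ∀ U : OddSet n, (if U ∈ A then X U else 0).trace = if U ∈ A then (X U).trace else 0 := fun U => by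
      split_ifs <;> simp
    rw [sum_congr rfl (fun U _ => e U), ← sum_filter, hAT]
  have hY : ∑ M, (if M ∈ B then Y M else 0) = ∑ M ∈ B, Y M := by
    rw [← sum_filter, filter_mem_eq_inter, univ_inter]
  have hYt : ∑ M, (if M ∈ B then Y M else 0).trace = ∑ M ∈ B, (Y M).trace := by
    have e : ∀ M : PMatch n, (if M ∈ B then Y M else 0).trace = if M ∈ B then (Y M).trace else 0 := fun M => by
      split_ifs <;> simp
    rw [sum_congr rfl (fun M _ => e M), ← sum_filter, filter_mem_eq_inter, univ_inter]
  rw [hX, hXt, hY, hYt] at h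
  exact h

/-- **Global misalignment on a cell, relative form.** With the cell's index densities `μ = |A|/C(n,t)`, `ν = |B|/|PM_n|`, relative trace densities
`τ̃_X = E_{U∈A} tr X_U / r`, `τ̃_Y = E_{M∈B} tr Y_M / r` and average overlap `ω̄ = E_{U∈A,M∈B} tr(X_U Y_M)/r`:  `ω̄ ≤ √(τ̃_X τ̃_Y/(n μ ν))`.
[cite: BrouwerHaemers2012, Prop. 4.3.2 (PDF p. 83)] [cite: GodsilMeagher2015, §15.2] -/
theorem cell_avg_overlap_le {r c' : ℕ} (hr : 0 < r) (hn : Even n) (ht : 2 * (2 * c' + 1) ≤ n)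
    {X : OddSet n → Matrix (Fin r) (Fin r) ℝ} {Y : PMatch n → Matrix (Fin r) (Fin r) ℝ} (hXY : IsPsdRect X Y)
    (A : Finset (OddSet n)) (hA : ∀ U ∈ A, U.1.card = 2 * c' + 1) (hA0 : A.Nonempty) (B : Finset (PMatch n)) (hB0 : B.Nonempty) :
    (∑ U ∈ A, ∑ M ∈ B, (X U * Y M).trace) / ((r : ℝ) * A.card * B.card) ≤
      Real.sqrt ((∑ U ∈ A, (X U).trace) / ((r : ℝ) * A.card) * ((∑ M ∈ B, (Y M).trace) / ((r : ℝ) * B.card)) /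
        ((n : ℝ) * ((A.card : ℝ) / (n.choose (2 * c' + 1) : ℝ)) * ((B.card : ℝ) / (Fintype.card (PMatch n) : ℝ)))) := by
  have h := cell_trace_sum_mul_sum_le hn ht hXY A hA B
  have htr : ((∑ U ∈ A, X U) * ∑ M ∈ B, Y M).trace = ∑ U ∈ A, ∑ M ∈ B, (X U * Y M).trace := by
    rw [sum_mul, trace_sum]
    exact sum_congr rfl fun U _ => by rw [mul_sum, trace_sum]
  rw [htr] at h
  set Cn : ℝ := (n.choose (2 * c' + 1) : ℝ) with hCn
  set PM : ℝ := (Fintype.card (PMatch n) : ℝ) with hPM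
  have hCpos : 0 < Cn := by rw [hCn]; exact_mod_cast Nat.choose_pos (by omega)
  have hPMpos : 0 < PM := by rw [hPM]; exact_mod_cast card_pmatch_pos hn
  have hr' : (0 : ℝ) < r := by exact_mod_cast hr
  have hn' : (0 : ℝ) < n := by exact_mod_cast (show 0 < n by omega)
  have hAc : (0 : ℝ) < A.card := by exact_mod_cast hA0.card_pos
  have hBc : (0 : ℝ) < B.card := by exact_mod_cast hB0.card_pos
  have hD : 0 < (r : ℝ) * A.card * B.card := by positivity
  calc (∑ U ∈ A, ∑ M ∈ B, (X U * Y M).trace) / ((r : ℝ) * A.card * B.card)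
      ≤ Real.sqrt (Cn * PM / n * ((∑ U ∈ A, (X U).trace) * ∑ M ∈ B, (Y M).trace)) / ((r : ℝ) * A.card * B.card) :=
        div_le_div_of_nonneg_right h hD.le
    _ = _ := by
        rw [← Real.sqrt_sq hD.le, ← Real.sqrt_div' _ (sq_nonneg _)]
        congr 1
        field_simp

/-- **Aligned cells are sparse.** In the setting of `cell_avg_overlap_le`, if the cell's average overlap is positive then
`μ·ν ≤ τ̃_X·τ̃_Y/(n·ω̄²)`; in particular a cell with `ω̄ ≥ θ·√(τ̃_X τ̃_Y)` has `μν ≤ 1/(θ²n)`. [cite: GodsilMeagher2015, §15.2] -/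
theorem cell_density_product_le {r c' : ℕ} (hr : 0 < r) (hn : Even n) (ht : 2 * (2 * c' + 1) ≤ n)
    {X : OddSet n → Matrix (Fin r) (Fin r) ℝ} {Y : PMatch n → Matrix (Fin r) (Fin r) ℝ} (hXY : IsPsdRect X Y)
    (A : Finset (OddSet n)) (hA : ∀ U ∈ A, U.1.card = 2 * c' + 1) (hA0 : A.Nonempty) (B : Finset (PMatch n)) (hB0 : B.Nonempty)
    (hω : 0 < (∑ U ∈ A, ∑ M ∈ B, (X U * Y M).trace) / ((r : ℝ) * A.card * B.card)) :
    ((A.card : ℝ) / (n.choose (2 * c' + 1) : ℝ)) * ((B.card : ℝ) / (Fintype.card (PMatch n) : ℝ)) ≤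
      (∑ U ∈ A, (X U).trace) / ((r : ℝ) * A.card) * ((∑ M ∈ B, (Y M).trace) / ((r : ℝ) * B.card)) /
        ((n : ℝ) * ((∑ U ∈ A, ∑ M ∈ B, (X U * Y M).trace) / ((r : ℝ) * A.card * B.card)) ^ 2) := by
  have h := cell_avg_overlap_le hr hn ht hXY A hA hA0 B hB0
  set ω : ℝ := (∑ U ∈ A, ∑ M ∈ B, (X U * Y M).trace) / ((r : ℝ) * A.card * B.card) with hωdef
  set τ : ℝ := (∑ U ∈ A, (X U).trace) / ((r : ℝ) * A.card) * ((∑ M ∈ B, (Y M).trace) / ((r : ℝ) * B.card)) with hτ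
  set μν : ℝ := ((A.card : ℝ) / (n.choose (2 * c' + 1) : ℝ)) * ((B.card : ℝ) / (Fintype.card (PMatch n) : ℝ)) with hμν
  have hCpos : (0 : ℝ) < (n.choose (2 * c' + 1) : ℝ) := by exact_mod_cast Nat.choose_pos (by omega)
  have hPMpos : (0 : ℝ) < (Fintype.card (PMatch n) : ℝ) := by exact_mod_cast card_pmatch_pos hn
  have hn' : (0 : ℝ) < n := by exact_mod_cast (show 0 < n by omega)
  have hAc : (0 : ℝ) < A.card := by exact_mod_cast hA0.card_pos
  have hBc : (0 : ℝ) < B.card := by exact_mod_cast hB0.card_pos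
  have hμνpos : 0 < μν := by rw [hμν]; positivity
  -- square `ω ≤ √(τ/(n μν))`
  have h' : ω ≤ Real.sqrt (τ / ((n : ℝ) * μν)) := by
    have e : (n : ℝ) * ((A.card : ℝ) / (n.choose (2 * c' + 1) : ℝ)) * ((B.card : ℝ) / (Fintype.card (PMatch n) : ℝ)) = (n : ℝ) * μν := by
      rw [hμν]; ring
    rw [← e]; exact h
  have hτ0 : 0 ≤ τ / ((n : ℝ) * μν) := by
    by_contra hneg
    push Not at hneg
    have : Real.sqrt (τ / ((n : ℝ) * μν)) = 0 := Real.sqrt_eq_zero'.2 hneg.le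
    rw [this] at h'
    exact absurd h' (not_le.2 hω)
  have h2 : ω ^ 2 ≤ τ / ((n : ℝ) * μν) := (Real.le_sqrt hω.le hτ0).1 h'
  rw [le_div_iff₀ (by positivity)] at h2
  rw [le_div_iff₀ (by positivity)]
  calc μν * ((n : ℝ) * ω ^ 2) = ω ^ 2 * ((n : ℝ) * μν) := by ring
    _ ≤ τ := h2

end Summit.PneNP.PneNP.Theorems.ChebyshevTracialDesignGlobalMisalignmentCells

end
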